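import Mathlib

/-!
# Solo-blind seat (MatrixMultiplication), s78 — no term of a short zero-sum-free sequence need be duplicable (rank 5)
(paper/KraftK3.md §7.21, K3.21.15 and its correction; CLAIMS c839–c842)

Background (door I1⁗, the Kraft inequality (K₃) for zero-sum-free sequences over `𝔽₃`).  A zero-sum-free sequence `h` over `𝔽₃` of
rank `ρ` has length at most `2ρ` (Olson).  Call a term `t` of `h` DUPLICABLE if the sequence `h, t` (one more copy of `t`) is still zero-sum
free; equivalently `t` is not a subset sum of the other terms.  The 'duplication lemma' Y — every zero-sum-free `h` with `|h| < 2ρ` has a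
duplicable term — would reduce the Davenport-deficiency slack laws of the programme to the plain layer bounds (KraftK3 K3.21.14–15); a complete
enumeration shows that Y HOLDS for all zero-sum-free sequences of rank `≤ 4` (3.08·10⁸ multisets) and FAILS from rank 5 on (280 155 normal forms
in rank 5, the shortest of length 8).

This file certifies the smallest failure in the kernel: the zero-sum-free SET
`h = (e₁, e₂, e₃, e₄, e₅, e₁+e₂+e₃+e₄, 2e₁+2e₂+e₃+e₄+e₅, 2e₁+2e₃+e₄+2e₅) ⊂ 𝔽₃⁵` of length `8 < 10 = 2·5`
(`soloBlindDup_zsf`, all `2^8` subsets; it contains the standard basis, so its rank is 5) in which EVERY term is the sum of four other terms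
(`soloBlindDup_wit_spec`), so that duplicating any term creates a zero sum `t + t + (four others) = 3t = 0` (`soloBlindDup_no_duplicable`);
nevertheless `h` is NOT maximal: appending `x = 2e₃ + e₅` keeps it zero-sum free (`soloBlindDup_ext_zsf`, all `2^9` subsets) — in rank 5 every
maximal zero-sum-free sequence has maximum length (K3.18.1), but extension by a DUPLICATE can be impossible.  (From rank 6 on even extension
fails: `SoloBlindMaximalZSF`.)  Pure finite combinatorics (`decide +kernel`); no `ω` content.
-/

set_option linter.dupNamespace false
set_option autoImplicit false

namespace Summit.MatrixMultiplication.MatrixMultiplication.Theorems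

open Finset BigOperators

/-- The group `𝔽₃⁵` as a nested product (computation-friendly for `decide`). -/
abbrev SoloBlindDupG5 : Type := ZMod 3 × ZMod 3 × ZMod 3 × ZMod 3 × ZMod 3

/-- The explicit zero-sum-free set of 8 vectors in `𝔽₃⁵`: the standard basis and
`e₁+e₂+e₃+e₄`, `2e₁+2e₂+e₃+e₄+e₅`, `2e₁+2e₃+e₄+2e₅`. -/
def soloBlindDup_h : Fin 8 → SoloBlindDupG5 :=
  ![(1, 0, 0, 0, 0), (0, 1, 0, 0, 0), (0, 0, 1, 0, 0), (0, 0, 0, 1, 0), (0, 0, 0, 0, 1),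
    (1, 1, 1, 1, 0), (2, 2, 1, 1, 1), (2, 0, 2, 1, 2)]

/-- For each term, four OTHER terms summing to it. -/
def soloBlindDup_wit : Fin 8 → Finset (Fin 8) :=
  ![{1, 3, 6, 7}, {3, 4, 5, 7}, {0, 5, 6, 7}, {0, 2, 4, 7}, {2, 3, 5, 6}, {0, 1, 2, 3}, {0, 1, 4, 5}, {1, 2, 4, 6}]

/-- The extended sequence `h, x` with `x = 2e₃ + e₅` appended (length 9). -/
def soloBlindDup_ext : Fin 9 → SoloBlindDupG5 :=
  ![(1, 0, 0, 0, 0), (0, 1, 0, 0, 0), (0, 0, 1, 0, 0), (0, 0, 0, 1, 0), (0, 0, 0, 0, 1),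
    (1, 1, 1, 1, 0), (2, 2, 1, 1, 1), (2, 0, 2, 1, 2), (0, 0, 2, 0, 1)]

/-- The eight terms are pairwise distinct (a set) and the first five are the standard basis (so the rank is 5). -/
theorem soloBlindDup_injective_basis : Function.Injective soloBlindDup_h ∧
    soloBlindDup_h 0 = (1, 0, 0, 0, 0) ∧ soloBlindDup_h 1 = (0, 1, 0, 0, 0) ∧ soloBlindDup_h 2 = (0, 0, 1, 0, 0) ∧
    soloBlindDup_h 3 = (0, 0, 0, 1, 0) ∧ soloBlindDup_h 4 = (0, 0, 0, 0, 1) := by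
  refine ⟨?_, by decide, by decide, by decide, by decide, by decide⟩
  intro i j hij
  revert i j
  decide

set_option maxHeartbeats 0 in
/-- ZERO-SUM FREE: the only subset of `h` summing to zero is the empty one (all `2^8` subsets, in the kernel). -/
theorem soloBlindDup_zsf : ∀ T : Finset (Fin 8), ∑ i ∈ T, soloBlindDup_h i = 0 → T = ∅ := by
  decide +kernel

/-- EVERY TERM IS A SUM OF FOUR OTHERS: `i ∉ wit i`, `|wit i| = 4` and `∑_{j ∈ wit i} h j = h i`. -/
theorem soloBlindDup_wit_spec : ∀ i : Fin 8,
    i ∉ soloBlindDup_wit i ∧ (soloBlindDup_wit i).card = 4 ∧ ∑ j ∈ soloBlindDup_wit i, soloBlindDup_h j = soloBlindDup_h i := by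
  decide +kernel

/-- NO TERM IS DUPLICABLE: for every `i`, two copies of `h i` together with the four witnesses form a zero sum
(`2·h i + h i = 0` in characteristic 3), so the sequence `h, h i` is not zero-sum free. -/
theorem soloBlindDup_no_duplicable : ∀ i : Fin 8,
    i ∉ soloBlindDup_wit i ∧ soloBlindDup_h i + soloBlindDup_h i + ∑ j ∈ soloBlindDup_wit i, soloBlindDup_h j = 0 := by
  decide +kernel

/-- The extension agrees with `h` on the first 8 terms and appends `x = (0,0,2,0,1)`. -/
theorem soloBlindDup_ext_spec : (∀ i : Fin 8, soloBlindDup_ext (Fin.castSucc i) = soloBlindDup_h i) ∧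
    soloBlindDup_ext (Fin.last 8) = (0, 0, 2, 0, 1) := by
  decide +kernel

set_option maxHeartbeats 0 in
/-- BUT `h` IS EXTENDABLE: the sequence `h, x` of length 9 is still zero-sum free (all `2^9` subsets, in the kernel). -/
theorem soloBlindDup_ext_zsf : ∀ T : Finset (Fin 9), ∑ i ∈ T, soloBlindDup_ext i = 0 → T = ∅ := by
  decide +kernel

/-- SUMMARY (the duplication lemma fails in rank 5): there is an injective zero-sum-free `h : Fin 8 → 𝔽₃⁵` containing the standard
basis (rank 5, length `8 < 10`) such that for every term some two copies of it plus four other terms sum to zero — no term can be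
duplicated — although a ninth, new element can still be appended keeping zero-sum freeness. -/
theorem soloBlind_duplication_obstruction :
    ∃ h : Fin 8 → SoloBlindDupG5, Function.Injective h ∧
      (∀ T : Finset (Fin 8), ∑ i ∈ T, h i = 0 → T = ∅) ∧
      (h 0 = (1, 0, 0, 0, 0) ∧ h 1 = (0, 1, 0, 0, 0) ∧ h 2 = (0, 0, 1, 0, 0) ∧ h 3 = (0, 0, 0, 1, 0) ∧ h 4 = (0, 0, 0, 0, 1)) ∧
      (∀ i : Fin 8, ∃ S : Finset (Fin 8), i ∉ S ∧ h i + h i + ∑ j ∈ S, h j = 0) ∧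
      (∃ g : Fin 9 → SoloBlindDupG5, (∀ i : Fin 8, g (Fin.castSucc i) = h i) ∧ ∀ T : Finset (Fin 9), ∑ i ∈ T, g i = 0 → T = ∅) := by
  refine ⟨soloBlindDup_h, soloBlindDup_injective_basis.1, soloBlindDup_zsf, soloBlindDup_injective_basis.2, ?_, ?_⟩
  · intro i
    exact ⟨soloBlindDup_wit i, (soloBlindDup_no_duplicable i).1, (soloBlindDup_no_duplicable i).2⟩
  · exact ⟨soloBlindDup_ext, soloBlindDup_ext_spec.1, soloBlindDup_ext_zsf⟩

end Summit.MatrixMultiplication.MatrixMultiplication.Theorems
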